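import Mathlib
import Summits.Ventures.DiscreteObjects.Mahler.CensusAuxiliaryCuts

/-!
# Explicit-auxiliary-function cuts with logarithmic slack (venture `DiscreteObjects`, target L)

Cell `pub-namedobj`, seat `pub-namedobj-mahler-g15`. Framing: lottery ticket; floor = certified bounds/negative
ranges.

Variant of `CensusAuxiliaryCuts` (seat g14) in which the off-circle slack of the hypothesis is `c · log ‖z‖` instead of
`c · √(‖z‖ + ‖z‖⁻¹ - 2)`.  With the auxiliary function `F = auxF a qs` of that file
(`F(z) = Σ_k a_k Re(z^k + z^{-k})/2 - Σ_j e_j log ‖Q_j(z) Q_j(z⁻¹)‖`), HYPOTHESIS (H_log) = `AuxBoundLog a qs B m₀ c` is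

  `F(z) ≥ -m₀ - c · log ‖z‖`  for `1 ≤ ‖z‖ ≤ B`, off the zeros of the `q̂_j`.

CONCLUSION (`auxCutLog_halfRoots`): for a reciprocal root configuration `s` (`d = |s|`, measure `M ≤ B`) with nonzero
resultants (`1 ≤ ∏_{α∈s} ‖q̂_j(α)‖`, automatic for irreducible `P` of degree `> deg Q_j`):

  `Σ_k a_k · Re s_k ≥ -2d·m₀ - 2c·log B`,

because the slack is ADDITIVE over the roots: `Σ_α log max(‖α‖, ‖α‖⁻¹) = log M ≤ log B` (`mahlerMeasure_halfRoots`).  The point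
of the logarithmic form: `-m₀ - c log ‖z‖` is harmonic, so (H_log) on the annulus follows from its two boundary circles by the
maximum-modulus principle (file `CensusAuxiliaryCircles`), which turns the certification of (H_log) into two ONE-dimensional
rational-interval checks; with `c = (m_B - m₀)/log B` the cut reads `Σ a_k P_k ≥ -(2d-2) m₀ - 2 m_B` where `-m₀`, `-m_B` bound `F`
below on `‖z‖ = 1`, `‖z‖ = B` (Flammang–Rhin–Sac-Épée, Math. Comp. 75 (2006) §3; Mossinghoff–Rhin–Wu 2008, method).
`acutLog_holds` is the integer form `0 ≤ N + Σ_k a_k P_k` for irreducible palindromic `p` (`CutValidAL`, table format of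
`censusSearchC`).  The certification of (H_log) is NOT in this file.
-/

namespace Summit.Ventures.DiscreteObjects.Mahler

open Polynomial

/-- HYPOTHESIS (H_log): `F(z) ≥ -m₀ - c · log ‖z‖` on the annulus `1 ≤ ‖z‖ ≤ B`, off the zeros of the `q̂_j`. -/
def AuxBoundLog (a : List ℤ) (qs : List (List ℤ × ℚ)) (B m₀ c : ℝ) : Prop :=
  ∀ z : ℂ, 1 ≤ ‖z‖ → ‖z‖ ≤ B → (∀ j < qs.length, qhat (qs.getD j ([], 0)).1 z ≠ 0) →
    -m₀ - c * Real.log ‖z‖ ≤ auxF a qs z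

/-- (H_log) is monotone in the radius bound. -/
theorem AuxBoundLog.mono {a : List ℤ} {qs : List (List ℤ × ℚ)} {B B' m₀ c : ℝ} (h : AuxBoundLog a qs B m₀ c)
    (hB : B' ≤ B) : AuxBoundLog a qs B' m₀ c :=
  fun z h1 h2 hq => h z h1 (h2.trans hB) hq

/-! ## The cut -/

/-- **The explicit-auxiliary-function cut (logarithmic slack) for a reciprocal root configuration.** -/
theorem auxCutLog_halfRoots (s : Multiset ℂ) (hs : ∀ α ∈ s, α ≠ 0) (a : List ℤ) (qs : List (List ℤ × ℚ))
    {B m₀ c : ℝ} (hc : 0 ≤ c) (he : ∀ j < qs.length, 0 ≤ (qs.getD j ([], 0)).2) (hH : AuxBoundLog a qs B m₀ c)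
    (hB : (s.map fun α => ((X - C α) * (X - C α⁻¹) : ℂ[X])).prod.mahlerMeasure ≤ B)
    (hres : ∀ j < qs.length, 1 ≤ (s.map fun α => ‖qhat (qs.getD j ([], 0)).1 α‖).prod) :
    -(2 * (Multiset.card s : ℝ)) * m₀ - 2 * c * Real.log B ≤
      ∑ k ∈ Finset.range a.length, ((a.getD k 0 : ℤ) : ℝ) * ((s.map fun α => α ^ (k + 1) + α⁻¹ ^ (k + 1)).sum).re := by
  set P := (s.map fun α => ((X - C α) * (X - C α⁻¹) : ℂ[X])).prod with hP
  have hmonic : P.Monic := by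
    rw [hP]; apply monic_multiset_prod_of_monic; intro α _
    exact (monic_X_sub_C _).mul (monic_X_sub_C _)
  have hM1 : 1 ≤ P.mahlerMeasure := by
    apply one_le_mahlerMeasure_of_one_le_norm_leadingCoeff
    rw [hmonic.leadingCoeff, norm_one]
  -- `log M = Σ_α |log ‖α‖| ≤ log B`
  have hlogM : Real.log P.mahlerMeasure = (s.map fun α => |Real.log ‖α‖|).sum := by
    rw [hP, mahlerMeasure_halfRoots s hs, Real.log_exp]
  have hsum_le : (s.map fun α => |Real.log ‖α‖|).sum ≤ Real.log B := by
    rw [← hlogM]; exact Real.log_le_log (by linarith) hB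
  -- (H_log) at each half-root: `-m₀ - c |log ‖α‖| ≤ F(α)`
  have hone : ∀ α ∈ s, -m₀ - c * |Real.log ‖α‖| ≤ auxF a qs α := by
    intro α hα
    have hα0 := hs α hα
    have hr : 0 < ‖α‖ := norm_pos_iff.mpr hα0
    have hnz : ∀ j < qs.length, qhat (qs.getD j ([], 0)).1 α ≠ 0 := by
      intro j hj h0
      have : (s.map fun α => ‖qhat (qs.getD j ([], 0)).1 α‖).prod = 0 :=
        Multiset.prod_eq_zero (Multiset.mem_map.mpr ⟨α, hα, by rw [h0, norm_zero]⟩)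
      have h1 := hres j hj
      rw [this] at h1
      exact absurd h1 (by norm_num)
    -- `|log ‖α‖| ≤ log M ≤ log B`, hence `exp |log ‖α‖| ≤ B`
    have hle : |Real.log ‖α‖| ≤ Real.log B := by
      refine le_trans ?_ hsum_le
      exact Multiset.single_le_sum (fun x hx => by
        obtain ⟨β, _, rfl⟩ := Multiset.mem_map.mp hx; exact abs_nonneg _) _
        (Multiset.mem_map.mpr ⟨α, hα, rfl⟩)
    have hB0 : 0 < B := by linarith
    rcases le_or_gt 1 ‖α‖ with h1 | h1
    · have hlog0 : 0 ≤ Real.log ‖α‖ := Real.log_nonneg h1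
      rw [abs_of_nonneg hlog0] at hle ⊢
      have hRle : ‖α‖ ≤ B := by
        rw [← Real.exp_log hr, ← Real.exp_log hB0]; exact Real.exp_le_exp.mpr hle
      exact hH α h1 hRle hnz
    · have hlogneg : Real.log ‖α‖ < 0 := Real.log_neg hr h1
      have hinv1 : 1 ≤ ‖α⁻¹‖ := by rw [norm_inv]; exact one_le_inv_iff₀.mpr ⟨hr, h1.le⟩
      rw [abs_of_neg hlogneg] at hle ⊢
      have hRle : ‖α⁻¹‖ ≤ B := by
        rw [norm_inv, ← Real.exp_log (inv_pos.mpr hr), ← Real.exp_log hB0, Real.log_inv]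
        exact Real.exp_le_exp.mpr hle
      have := hH α⁻¹ hinv1 hRle (fun j hj => by rw [qhat_inv]; exact hnz j hj)
      rw [norm_inv, Real.log_inv, auxF_inv] at this
      simpa using this
  have hsum := Multiset.sum_map_le_sum_map _ _ hone
  rw [Multiset.sum_map_sub, Multiset.map_const', Multiset.sum_replicate, Multiset.sum_map_mul_left] at hsum
  simp only [nsmul_eq_mul] at hsum
  have hleft : -(Multiset.card s : ℝ) * m₀ - c * Real.log B ≤
      (Multiset.card s : ℝ) * (-m₀) - c * (s.map fun α => |Real.log ‖α‖|).sum := by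
    nlinarith
  -- right side: `Σ_α F(α) = ½ Σ_k a_k Re s_k - Σ_j e_j log ∏ ‖q̂_j‖ ≤ ½ Σ_k a_k Re s_k`
  have hA : (s.map fun α => ∑ k ∈ Finset.range a.length,
      ((a.getD k 0 : ℤ) : ℝ) * ((α ^ (k + 1) + α⁻¹ ^ (k + 1)).re / 2)).sum =
      ∑ k ∈ Finset.range a.length, ((a.getD k 0 : ℤ) : ℝ) * (((s.map fun α => α ^ (k + 1) + α⁻¹ ^ (k + 1)).sum).re / 2) := by
    rw [multiset_sum_finset_sum]
    apply Finset.sum_congr rfl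
    intro k _
    rw [Multiset.sum_map_mul_left]
    congr 1
    have h := map_multiset_sum Complex.reAddGroupHom (s.map fun α => α ^ (k + 1) + α⁻¹ ^ (k + 1))
    rw [Multiset.map_map] at h
    change ((s.map fun α => α ^ (k + 1) + α⁻¹ ^ (k + 1)).sum).re = (s.map fun α => (α ^ (k + 1) + α⁻¹ ^ (k + 1)).re).sum at h
    rw [h, Multiset.sum_map_div]
  have hL : 0 ≤ (s.map fun α => ∑ j ∈ Finset.range qs.length,
      (((qs.getD j ([], 0)).2 : ℚ) : ℝ) * Real.log ‖qhat (qs.getD j ([], 0)).1 α‖).sum := by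
    rw [multiset_sum_finset_sum]
    apply Finset.sum_nonneg
    intro j hj
    rw [Finset.mem_range] at hj
    rw [Multiset.sum_map_mul_left]
    apply mul_nonneg (by exact_mod_cast he j hj)
    have hpos : ∀ x ∈ (s.map fun α => ‖qhat (qs.getD j ([], 0)).1 α‖), 0 < x := by
      intro x hx
      obtain ⟨α, hα, rfl⟩ := Multiset.mem_map.mp hx
      rcases (norm_nonneg (qhat (qs.getD j ([], 0)).1 α)).eq_or_lt with h | h
      · exfalso
        have h0 : (s.map fun α => ‖qhat (qs.getD j ([], 0)).1 α‖).prod = 0 :=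
          Multiset.prod_eq_zero (Multiset.mem_map.mpr ⟨α, hα, h.symm⟩)
        have h1 := hres j hj
        rw [h0] at h1; exact absurd h1 (by norm_num)
      · exact h
    have := log_multiset_prod_eq_sum _ hpos
    rw [Multiset.map_map] at this
    change Real.log _ = (s.map fun α => Real.log ‖qhat (qs.getD j ([], 0)).1 α‖).sum at this
    rw [← this]
    exact Real.log_nonneg (hres j hj)
  have hF : (s.map fun α => auxF a qs α).sum ≤
      ∑ k ∈ Finset.range a.length, ((a.getD k 0 : ℤ) : ℝ) * (((s.map fun α => α ^ (k + 1) + α⁻¹ ^ (k + 1)).sum).re / 2) := by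
    unfold auxF
    rw [Multiset.sum_map_sub, hA]
    linarith
  have h2 : ∑ k ∈ Finset.range a.length, ((a.getD k 0 : ℤ) : ℝ) * ((s.map fun α => α ^ (k + 1) + α⁻¹ ^ (k + 1)).sum).re =
      2 * ∑ k ∈ Finset.range a.length, ((a.getD k 0 : ℤ) : ℝ) * (((s.map fun α => α ^ (k + 1) + α⁻¹ ^ (k + 1)).sum).re / 2) := by
    rw [Finset.mul_sum]
    apply Finset.sum_congr rfl
    intro k _; ring
  rw [h2]
  linarith

/-! ## Integer polynomials -/

/-- An auxiliary-function cut `([a_k,…,a_1], N)` at depth `k` with LOGARITHMIC slack is VALID for `(d, B)` if some family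
`(v_j, e_j)` (`e_j ≥ 0`, `v_j` of length `≤ 2d` with a nonzero entry) and constants `m₀`, `c ≥ 0` satisfy (H_log) = `AuxBoundLog`
with `2d·m₀ + 2c·log B < N + 1`. -/
def CutValidAL (d k : ℕ) (B : ℝ) (ct : List ℤ × ℤ) : Prop :=
  ct.1.length = k ∧ ∃ (qs : List (List ℤ × ℚ)) (m₀ c : ℝ), 0 ≤ c ∧ (∀ j < qs.length, 0 ≤ (qs.getD j ([], 0)).2) ∧
    (∀ j < qs.length, (qs.getD j ([], 0)).1.length ≤ 2 * d ∧ ∃ i, (qs.getD j ([], 0)).1.getD i 0 ≠ 0) ∧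
    AuxBoundLog ct.1.reverse qs B m₀ c ∧ 2 * (d : ℝ) * m₀ + 2 * c * Real.log B < (ct.2 : ℝ) + 1

/-- **The auxiliary-function cuts (logarithmic slack) hold for small-measure IRREDUCIBLE palindromic polynomials**: for
monic irreducible palindromic `p ∈ ℤ[X]` of degree `2d` with `M(p) < B` and a valid cut `ct` of depth `k`:
`0 ≤ N + Σ_j a_j P_j(p)`. -/
theorem acutLog_holds {p : ℤ[X]} {d : ℕ} (hmonic : p.Monic) (hirr : Irreducible p) (hdeg : p.natDegree = 2 * d)
    (hpal : ∀ j ≤ 2 * d, p.coeff j = p.coeff (2 * d - j)) {B : ℝ} (hB : intMahlerMeasure p < B) {k : ℕ}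
    {ct : List ℤ × ℤ} (hc : CutValidAL d k B ct) :
    0 ≤ ct.2 + (List.zipWith (· * ·) ct.1 (psumsRev (descCoeffList p) k)).sum := by
  obtain ⟨hlen, qs, m₀, c, hc0, he, hqs, hH, hconst⟩ := hc
  obtain ⟨s', hcard, hs0, hP⟩ := palindromic_halfRoots_factorisation (p.map (Int.castRingHom ℂ)) d
    (hmonic.map _) (by rw [natDegree_map_eq_of_injective (Int.castRingHom ℂ).injective_int, hdeg])
    (fun j hj => by rw [coeff_map, coeff_map, hpal j hj])
  have hB' : (s'.map fun α => ((X - C α) * (X - C α⁻¹) : ℂ[X])).prod.mahlerMeasure ≤ B := by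
    rw [← hP]; exact hB.le
  have hres : ∀ j < qs.length, 1 ≤ (s'.map fun α => ‖qhat (qs.getD j ([], 0)).1 α‖).prod := by
    intro j hj
    obtain ⟨hl, hnz⟩ := hqs j hj
    exact one_le_prod_norm_vEval_halfRoots hmonic hirr hP _ (by rw [hdeg]; exact hl) hnz
  have hcut := auxCutLog_halfRoots s' hs0 ct.1.reverse qs hc0 he hH hB' hres
  rw [hcard, List.length_reverse, hlen] at hcut
  have hre : ∀ j ∈ Finset.range k, ((s'.map fun α => α ^ (j + 1) + α⁻¹ ^ (j + 1)).sum).re =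
      (((psumsRev (descCoeffList p) (j + 1)).getD 0 0 : ℤ) : ℝ) := by
    intro j _
    rw [← roots_powerSum_eq, ← hP, ← rootPowerSum_def, rootPowerSum_eq_head hmonic (by omega), Complex.intCast_re]
  rw [Finset.sum_congr rfl (fun j hj => by rw [hre j hj])] at hcut
  rw [sum_zipWith_psumsRev ct.1 _ k]
  have hget : ∀ j < k, ct.1.reverse.getD j 0 = ct.1.getD (k - 1 - j) 0 := by
    intro j hj
    rw [List.getD_eq_getElem?_getD, List.getElem?_reverse (by omega), hlen, List.getD_eq_getElem?_getD]
  have hsum : (((∑ j ∈ Finset.range k, ct.1.getD (k - 1 - j) 0 * (psumsRev (descCoeffList p) (j + 1)).getD 0 0 : ℤ)) : ℝ)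
      = ∑ j ∈ Finset.range k, ((ct.1.reverse.getD j 0 : ℤ) : ℝ) * (((psumsRev (descCoeffList p) (j + 1)).getD 0 0 : ℤ) : ℝ) := by
    push_cast
    apply Finset.sum_congr rfl
    intro j hj
    rw [Finset.mem_range] at hj
    rw [hget j hj]
  have key : (-(ct.2 + 1) : ℝ) <
      ((∑ j ∈ Finset.range k, ct.1.getD (k - 1 - j) 0 * (psumsRev (descCoeffList p) (j + 1)).getD 0 0 : ℤ) : ℝ) := by
    rw [hsum]; linarith
  have key' : -(ct.2 + 1) < ∑ j ∈ Finset.range k, ct.1.getD (k - 1 - j) 0 * (psumsRev (descCoeffList p) (j + 1)).getD 0 0 := by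
    exact_mod_cast key
  omega

end Summit.Ventures.DiscreteObjects.Mahler
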